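import Literature.Analysis.Complex.BernsteinLaxInequalities
import HarnessLib

/-!
# Bernstein's inequality `‖t'‖ ≤ n‖t‖` and the Bernstein–Szegő inequality `t'² + n²t² ≤ n²‖t‖²` for trigonometric polynomials

Topic `Literature/Analysis/Approximation`, namespace
`Literature.Analysis.Approximation.TrigonometricBernsteinInequality`; sequel of
`Literature/Analysis/Complex/BernsteinLaxInequalities.lean` (Szegő's inequality
`|NQ(z) − zQ'(z)| + |Q'(z)| ≤ N‖Q‖` for `Q ∈ ℂ[X]`, `deg Q ≤ N`, `|z| = 1`).

Sources: P. Borwein – T. Erdélyi, *Polynomials and Polynomial Inequalities* (GTM 161, 1995) §5.1,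
Theorem 5.1.3 (Bernstein–Szegő inequality), Theorem 5.1.4 (Bernstein's inequality
`‖t^{(m)}‖_K ≤ nᵐ‖t‖_K`, `t ∈ 𝒯ₙ`), Corollary 5.1.5 (the same for `t ∈ 𝒯ₙᶜ`) [BorweinErdelyi1995];
T. Sheil-Small, *Complex Polynomials* (CUP 2002) §4.4.7 Theorem (4.189) [SheilSmall2002].

## The road (Sheil-Small §4.4, «zⁿT is a polynomial of degree 2n»)

A trigonometric polynomial `T` of degree `≤ n` is `T(θ) = e^{−inθ} Q(e^{iθ})` with `Q ∈ ℂ[X]`,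
`deg Q ≤ 2n`, and `‖Q‖_𝕋 = ‖T‖`. Differentiating `T(θ)e^{inθ} = Q(e^{iθ})`:
`zQ'(z) = −i e^{inθ}(T' + inT)`, `2nQ(z) − zQ'(z) = e^{inθ}(nT + iT')`, so Szegő's inequality with
`N = 2n` reads `|nT + iT'| + |T' + inT| ≤ 2n‖T‖` (`norm_add_norm_le`). Since
`2T' = (T' + inT) − i(nT + iT')`, **`|T'(θ)| ≤ n‖T‖`** (complex coefficients, Cor. 5.1.5 / Thm 4.4.7);
and when `T(θ), T'(θ)` are REAL the two moduli both equal `√(T'² + n²T²)`, whence the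
**Bernstein–Szegő inequality `T'(θ)² + n²T(θ)² ≤ n²‖T‖²`** (Thm 5.1.3; van der Corput–Schaake).
Borwein–Erdélyi prove 5.1.3 by a zero-counting argument against `cos(nτ − α)` and deduce 5.1.4–5.1.6
from it; here the order is reversed (5.1.6's complex form ⇒ 5.1.3), as in Sheil-Small.

## Main statements (theorems only; no definitions, no named facts)

* `mul_eval_derivative_eq`, `norm_add_norm_le`, `norm_deriv_le_of_repr`, `sq_add_sq_le_of_repr` — the
  engine for any `F : ℝ → ℂ` with `F(θ)e^{inθ} = Q(e^{iθ})`, `deg Q ≤ 2n`.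
* EXPONENTIAL FORM `T(θ) = Σ_{j=0}^{2n} d_j e^{i(j−n)θ}` (= `Σ_{k=−n}^{n} c_k e^{ikθ}`, `c_k = d_{k+n}`):
  `hasDerivAt_expSum`, **`trigBernstein_expSum`** (`|T'(θ)| ≤ n·M` whenever `|T| ≤ M`),
  `trigBernstein_expSum_deriv`, **`trigBernstein_expSum_iterate`** (`|T^{(m)}(θ)| ≤ nᵐ M`,
  Cor. 5.1.5).
* REAL FORM `t(θ) = Σ_{k=0}^{n} (a_k cos kθ + b_k sin kθ)` (`t ∈ 𝒯ₙ`): `hasDerivAt_cosSinSum`,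
  `deriv_cosSinSum`, **`bernsteinSzego`** (Thm 5.1.3: `t'(θ)² + n²t(θ)² ≤ n²M²`),
  **`trigBernstein`** (`|t'(θ)| ≤ nM`, Thm 5.1.4 with `m = 1` = Sheil-Small Thm 4.4.7),
  **`trigBernstein_iterate`** (`|t^{(m)}(θ)| ≤ nᵐM`, Thm 5.1.4), and the `sSup` form
  **`trigBernstein_sSup`** `‖deriv t x‖ ≤ n · sSup (range |t|)` — exactly the hypothesis `hB` of the
  tree's `Literature/Analysis/ValidatedNumerics/GridSupBound.lean` («the inequality is quoted, not
  proved, here»), now proved.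

Not formalised: the equality cases of Thm 5.1.3 / E.5–E.6 (`t = β cos(nτ − α)`), and the `L_p`
versions (A4 E.12–E.13).

## References

* [BorweinErdelyi1995] P. Borwein, T. Erdélyi, *Polynomials and Polynomial Inequalities*, GTM 161,
  Springer 1995, §5.1 Thm 5.1.3, Thm 5.1.4, Cor 5.1.5 (pp. 232–233) (held:
  `book:borwein1995-polynomials-polynomial-inequalities`, p0157–p0158).
* [SheilSmall2002] T. Sheil-Small, *Complex Polynomials*, CUP 2002, §4.4.7 Theorem (4.189) (p. 154) (held).
-/

noncomputable section

open Polynomial Complex Finset Set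

namespace Literature.Analysis.Approximation.TrigonometricBernsteinInequality

open Literature.Analysis.Complex.BernsteinLaxInequalities

/-! ## The engine: `F(θ) e^{inθ} = Q(e^{iθ})` -/

/-- `θ ↦ e^{icθ}` has derivative `ic·e^{icθ}` (real variable, complex `c`). [folklore] -/
private theorem hasDerivAt_cexp_mul_I (c : ℂ) (θ : ℝ) :
    HasDerivAt (fun θ : ℝ => cexp (c * θ * I)) (c * I * cexp (c * θ * I)) θ := by
  have h1 : HasDerivAt (fun w : ℂ => c * w * I) (c * 1 * I) (θ : ℂ) :=
    ((hasDerivAt_id (θ : ℂ)).const_mul c).mul_const I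
  have h2 := h1.cexp.comp_ofReal
  convert h2 using 1; ring

/-- `|e^{ixθ}| = 1` for real `x, θ` (here with a natural-number frequency). [folklore] -/
private theorem norm_cexp_natCast_mul (n : ℕ) (θ : ℝ) : ‖cexp (n * θ * I)‖ = 1 := by
  have : (n : ℂ) * θ * I = ((n * θ : ℝ) : ℂ) * I := by push_cast; ring
  rw [this, norm_exp_ofReal_mul_I]

/-- **Differentiating `F(θ)e^{inθ} = Q(e^{iθ})`:** if `F : ℝ → ℂ` satisfies this identity for all `θ`
and has derivative `F'(θ)` at `θ`, then with `z = e^{iθ}`,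
`zQ'(z) = −i e^{inθ} (F'(θ) + in F(θ))` (Sheil-Small: «|P'(z)| = |−ie^{−iτ}t'(τ)|»).
[cite: BorweinErdelyi1995, §5.1 proof of Cor. 5.1.6 (p. 233)] [cite: SheilSmall2002, §4.4.2–4.4.7 (pp. 152–154)] -/
theorem mul_eval_derivative_eq {n : ℕ} {Q : ℂ[X]} {F F' : ℝ → ℂ}
    (hFQ : ∀ θ : ℝ, F θ * cexp (n * θ * I) = Q.eval (cexp (θ * I))) {θ : ℝ}
    (hF : HasDerivAt F (F' θ) θ) :
    cexp (θ * I) * Q.derivative.eval (cexp (θ * I)) =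
      -I * cexp (n * θ * I) * (F' θ + n * I * F θ) := by
  have hE : HasDerivAt (fun θ : ℝ => cexp (n * θ * I)) (n * I * cexp (n * θ * I)) θ :=
    hasDerivAt_cexp_mul_I n θ
  have hG1 : HasDerivAt (fun θ : ℝ => F θ * cexp (n * θ * I))
      (F' θ * cexp (n * θ * I) + F θ * (n * I * cexp (n * θ * I))) θ := hF.mul hE
  have hz : HasDerivAt (fun w : ℂ => cexp (w * I)) (cexp (θ * I) * I) (θ : ℂ) := by
    have := ((hasDerivAt_id (θ : ℂ)).mul_const I).cexp
    simpa using this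
  have hG2c := HasDerivAt.comp (θ : ℂ) (Polynomial.hasDerivAt Q (cexp ((θ : ℂ) * I))) hz
  simp only [Function.comp_def] at hG2c
  have hG2 : HasDerivAt (fun θ : ℝ => Q.eval (cexp (θ * I)))
      (Q.derivative.eval (cexp (θ * I)) * (cexp (θ * I) * I)) θ := hG2c.comp_ofReal
  have hfun : (fun θ : ℝ => F θ * cexp (n * θ * I)) = fun θ : ℝ => Q.eval (cexp (θ * I)) :=
    funext hFQ
  rw [hfun] at hG1
  have heq := hG1.unique hG2
  linear_combination I * heq + (cexp (θ * I) * Q.derivative.eval (cexp (θ * I))) * I_sq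

/-- **Szegő's inequality transported to `F`:** if `F(θ)e^{inθ} = Q(e^{iθ})` with `deg Q ≤ 2n`,
`|F| ≤ M` everywhere, and `F` has derivative `F'(θ)` at `θ`, then
`|nF(θ) + iF'(θ)| + |F'(θ) + inF(θ)| ≤ 2nM` — the two moduli are `|2nQ(z) − zQ'(z)|` and `|Q'(z)|`.
[cite: SheilSmall2002, §4.4.2 Theorem (4.166) (p. 152)] [cite: BorweinErdelyi1995, §5.1 Cor. 5.1.5–5.1.6 (p. 233)] -/
theorem norm_add_norm_le {n : ℕ} {Q : ℂ[X]} (hQ : Q.natDegree ≤ 2 * n) {F F' : ℝ → ℂ}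
    (hFQ : ∀ θ : ℝ, F θ * cexp (n * θ * I) = Q.eval (cexp (θ * I))) {M : ℝ}
    (hM : ∀ θ : ℝ, ‖F θ‖ ≤ M) {θ : ℝ} (hF : HasDerivAt F (F' θ) θ) :
    ‖(n : ℂ) * F θ + I * F' θ‖ + ‖F' θ + n * I * F θ‖ ≤ 2 * n * M := by
  set z : ℂ := cexp (θ * I) with hzdef
  have hz1 : ‖z‖ = 1 := norm_exp_ofReal_mul_I θ
  have he1 : ‖cexp (n * θ * I)‖ = 1 := norm_cexp_natCast_mul n θ
  -- `‖Q‖_𝕋 ≤ M`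
  have hMQ : ∀ w : ℂ, ‖w‖ = 1 → ‖Q.eval w‖ ≤ M := by
    intro w hw
    have hw' : w = cexp ((arg w : ℂ) * I) := by
      have h := norm_mul_exp_arg_mul_I w
      rw [hw, ofReal_one, one_mul] at h
      exact h.symm
    rw [hw', ← hFQ (arg w), norm_mul, norm_cexp_natCast_mul, mul_one]
    exact hM (arg w)
  have hsz := szego (p := Q) (n := 2 * n) hQ hMQ hz1.le
  have hid := mul_eval_derivative_eq hFQ hF
  have hQz : Q.eval z = cexp (n * θ * I) * F θ := by rw [← hFQ θ, mul_comm]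
  have h1 : ‖Q.derivative.eval z‖ = ‖F' θ + n * I * F θ‖ := by
    have := congrArg (fun u : ℂ => ‖u‖) hid
    simp only [norm_mul, norm_neg, Complex.norm_I, he1, one_mul] at this
    rwa [← hzdef, hz1, one_mul] at this
  have h2 : ((2 * n : ℕ) : ℂ) * Q.eval z - z * Q.derivative.eval z =
      cexp (n * θ * I) * (n * F θ + I * F' θ) := by
    rw [hzdef, hid, ← hzdef, hQz]
    push_cast
    linear_combination ((n : ℂ) * cexp (n * θ * I) * F θ) * I_sq
  rw [h2, h1, norm_mul, he1, one_mul] at hsz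
  push_cast at hsz
  linarith

/-- **Bernstein's inequality in the abstract form:** under the hypotheses of `norm_add_norm_le`,
`|F'(θ)| ≤ nM` (from `2F' = (F' + inF) − i(nF + iF')`).
[cite: BorweinErdelyi1995, §5.1 Cor. 5.1.5 (p. 233)] [cite: SheilSmall2002, §4.4.7 Theorem (4.189) (p. 154)] -/
theorem norm_deriv_le_of_repr {n : ℕ} {Q : ℂ[X]} (hQ : Q.natDegree ≤ 2 * n) {F F' : ℝ → ℂ}
    (hFQ : ∀ θ : ℝ, F θ * cexp (n * θ * I) = Q.eval (cexp (θ * I))) {M : ℝ}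
    (hM : ∀ θ : ℝ, ‖F θ‖ ≤ M) {θ : ℝ} (hF : HasDerivAt F (F' θ) θ) : ‖F' θ‖ ≤ n * M := by
  have h := norm_add_norm_le hQ hFQ hM hF
  have h2 : (2 : ℂ) * F' θ = (F' θ + n * I * F θ) - I * (n * F θ + I * F' θ) := by
    linear_combination (F' θ) * I_sq
  have h3 : 2 * ‖F' θ‖ ≤ ‖F' θ + n * I * F θ‖ + ‖(n : ℂ) * F θ + I * F' θ‖ := by
    calc 2 * ‖F' θ‖ = ‖(2 : ℂ) * F' θ‖ := by rw [norm_mul]; norm_num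
      _ = ‖(F' θ + n * I * F θ) - I * (n * F θ + I * F' θ)‖ := by rw [h2]
      _ ≤ ‖F' θ + n * I * F θ‖ + ‖I * (n * F θ + I * F' θ)‖ := norm_sub_le _ _
      _ = ‖F' θ + n * I * F θ‖ + ‖(n : ℂ) * F θ + I * F' θ‖ := by
          rw [norm_mul, Complex.norm_I, one_mul]
  linarith

/-- **The Bernstein–Szegő inequality in the abstract form:** under the hypotheses of
`norm_add_norm_le`, if `F(θ)` and `F'(θ)` are REAL then `F'(θ)² + n²F(θ)² ≤ n²M²`
(both moduli in `norm_add_norm_le` equal `√(F'² + n²F²)`).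
[cite: BorweinErdelyi1995, §5.1 Thm 5.1.3 (pp. 232–233)] -/
theorem sq_add_sq_le_of_repr {n : ℕ} {Q : ℂ[X]} (hQ : Q.natDegree ≤ 2 * n) {F F' : ℝ → ℂ}
    (hFQ : ∀ θ : ℝ, F θ * cexp (n * θ * I) = Q.eval (cexp (θ * I))) {M : ℝ}
    (hM : ∀ θ : ℝ, ‖F θ‖ ≤ M) {θ : ℝ} (hF : HasDerivAt F (F' θ) θ)
    (hre : (F θ).im = 0) (hre' : (F' θ).im = 0) :
    (F' θ).re ^ 2 + (n : ℝ) ^ 2 * (F θ).re ^ 2 ≤ (n : ℝ) ^ 2 * M ^ 2 := by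
  have h := norm_add_norm_le hQ hFQ hM hF
  have hM0 : 0 ≤ M := (norm_nonneg _).trans (hM θ)
  set u : ℝ := (F θ).re
  set v : ℝ := (F' θ).re
  have hFu : F θ = u := Complex.ext (by simp [u]) (by simp [hre])
  have hFv : F' θ = v := Complex.ext (by simp [v]) (by simp [hre'])
  have hA : ‖(n : ℂ) * F θ + I * F' θ‖ = √(v ^ 2 + (n : ℝ) ^ 2 * u ^ 2) := by
    rw [hFu, hFv, show (n : ℂ) * (u : ℂ) + I * (v : ℂ) = ((n * u : ℝ) : ℂ) + (v : ℝ) * I by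
      push_cast; ring, norm_add_mul_I]
    congr 1; ring
  have hB : ‖F' θ + n * I * F θ‖ = √(v ^ 2 + (n : ℝ) ^ 2 * u ^ 2) := by
    rw [hFu, hFv, show (v : ℂ) + n * I * (u : ℂ) = ((v : ℝ) : ℂ) + ((n * u : ℝ) : ℂ) * I by
      push_cast; ring, norm_add_mul_I]
    congr 1; ring
  rw [hA, hB] at h
  have hs : √(v ^ 2 + (n : ℝ) ^ 2 * u ^ 2) ≤ n * M := by linarith
  have hx : 0 ≤ v ^ 2 + (n : ℝ) ^ 2 * u ^ 2 := by positivity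
  calc v ^ 2 + (n : ℝ) ^ 2 * u ^ 2 = (√(v ^ 2 + (n : ℝ) ^ 2 * u ^ 2)) ^ 2 := (Real.sq_sqrt hx).symm
    _ ≤ (n * M) ^ 2 := pow_le_pow_left₀ (Real.sqrt_nonneg _) hs 2
    _ = (n : ℝ) ^ 2 * M ^ 2 := by ring

/-! ## Trigonometric polynomials with complex coefficients (exponential form) -/

/-- The polynomial `Q = Σ_{j ≤ 2n} d_j Xʲ` attached to `T(θ) = Σ_{j ≤ 2n} d_j e^{i(j−n)θ}` has degree at
most `2n`. [cite: SheilSmall2002, §4.4 (p. 152)] -/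
theorem natDegree_expSum_le (n : ℕ) (d : ℕ → ℂ) :
    (∑ j ∈ range (2 * n + 1), C (d j) * X ^ j : ℂ[X]).natDegree ≤ 2 * n := by
  refine natDegree_sum_le_of_forall_le _ _ fun j hj => ?_
  exact (natDegree_C_mul_X_pow_le (d j) j).trans (Nat.lt_succ_iff.1 (mem_range.1 hj))

/-- `T(θ) e^{inθ} = Q(e^{iθ})` for `T(θ) = Σ_{j ≤ 2n} d_j e^{i(j−n)θ}`, `Q = Σ d_j Xʲ`.
[cite: BorweinErdelyi1995, §5.1 proof of Cor. 5.1.6 «t(θ) := p(e^{iθ}) ∈ 𝒯ₙᶜ» (p. 233)] -/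
theorem expSum_mul_cexp (n : ℕ) (d : ℕ → ℂ) (θ : ℝ) :
    (∑ j ∈ range (2 * n + 1), d j * cexp (((j : ℂ) - n) * θ * I)) * cexp (n * θ * I) =
      (∑ j ∈ range (2 * n + 1), C (d j) * X ^ j : ℂ[X]).eval (cexp (θ * I)) := by
  rw [eval_finsetSum, sum_mul]
  refine sum_congr rfl fun j _ => ?_
  rw [eval_mul, eval_C, eval_pow, eval_X, ← Complex.exp_nat_mul, mul_assoc, ← Complex.exp_add]
  congr 2; ring

/-- The derivative of `T(θ) = Σ_{j ≤ 2n} d_j e^{i(j−n)θ}` is `Σ d_j · i(j−n) · e^{i(j−n)θ}`. [folklore] -/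
private theorem hasDerivAt_expSum (n : ℕ) (d : ℕ → ℂ) (θ : ℝ) :
    HasDerivAt (fun θ : ℝ => ∑ j ∈ range (2 * n + 1), d j * cexp (((j : ℂ) - n) * θ * I))
      (∑ j ∈ range (2 * n + 1), d j * ((((j : ℂ) - n) * I) * cexp (((j : ℂ) - n) * θ * I))) θ :=
  HasDerivAt.fun_sum fun j _ => (hasDerivAt_cexp_mul_I ((j : ℂ) - n) θ).const_mul (d j)

/-- **Bernstein's inequality for trigonometric polynomials with complex coefficients**
(Borwein–Erdélyi Cor. 5.1.5 with `m = 1`; Sheil-Small Thm 4.4.7): if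
`T(θ) = Σ_{j=0}^{2n} d_j e^{i(j−n)θ}` (i.e. `Σ_{|k| ≤ n} c_k e^{ikθ}`) satisfies `|T(θ)| ≤ M` for all
real `θ`, then `|T'(θ)| = |Σ d_j i(j−n) e^{i(j−n)θ}| ≤ n·M` for all real `θ`.
[cite: BorweinErdelyi1995, §5.1 Cor. 5.1.5 (p. 233)] [cite: SheilSmall2002, §4.4.7 Theorem (4.189) (p. 154)] -/
theorem trigBernstein_expSum (n : ℕ) (d : ℕ → ℂ) {M : ℝ}
    (hM : ∀ θ : ℝ, ‖∑ j ∈ range (2 * n + 1), d j * cexp (((j : ℂ) - n) * θ * I)‖ ≤ M) (θ : ℝ) :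
    ‖∑ j ∈ range (2 * n + 1), d j * ((((j : ℂ) - n) * I) * cexp (((j : ℂ) - n) * θ * I))‖ ≤
      n * M :=
  norm_deriv_le_of_repr (natDegree_expSum_le n d) (expSum_mul_cexp n d) hM
    (F' := fun θ => ∑ j ∈ range (2 * n + 1), d j * ((((j : ℂ) - n) * I) * cexp (((j : ℂ) - n) * θ * I)))
    (hasDerivAt_expSum n d θ)

/-- `deriv` form of `trigBernstein_expSum`: `‖deriv T θ‖ ≤ n·M`.
[cite: BorweinErdelyi1995, §5.1 Cor. 5.1.5 (p. 233)] -/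
theorem trigBernstein_expSum_deriv (n : ℕ) (d : ℕ → ℂ) {M : ℝ}
    (hM : ∀ θ : ℝ, ‖∑ j ∈ range (2 * n + 1), d j * cexp (((j : ℂ) - n) * θ * I)‖ ≤ M) (θ : ℝ) :
    ‖deriv (fun θ : ℝ => ∑ j ∈ range (2 * n + 1), d j * cexp (((j : ℂ) - n) * θ * I)) θ‖ ≤
      n * M := by
  rw [(hasDerivAt_expSum n d θ).deriv]
  exact trigBernstein_expSum n d hM θ

/-- **Borwein–Erdélyi Cor. 5.1.5 (all orders):** `‖T^{(m)}‖ ≤ nᵐ‖T‖` for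
`T(θ) = Σ_{j=0}^{2n} d_j e^{i(j−n)θ}` — by induction, since `T'` is again of this form with coefficients
`d_j · i(j−n)`. [cite: BorweinErdelyi1995, §5.1 Thm 5.1.4 and Cor. 5.1.5 (p. 233)] -/
theorem trigBernstein_expSum_iterate (n : ℕ) (d : ℕ → ℂ) {M : ℝ}
    (hM : ∀ θ : ℝ, ‖∑ j ∈ range (2 * n + 1), d j * cexp (((j : ℂ) - n) * θ * I)‖ ≤ M)
    (m : ℕ) (θ : ℝ) :
    ‖deriv^[m] (fun θ : ℝ => ∑ j ∈ range (2 * n + 1), d j * cexp (((j : ℂ) - n) * θ * I)) θ‖ ≤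
      (n : ℝ) ^ m * M := by
  induction m generalizing d M θ with
  | zero => simpa using hM θ
  | succ m ih =>
    rw [Function.iterate_succ_apply]
    have hderiv : deriv (fun θ : ℝ => ∑ j ∈ range (2 * n + 1), d j * cexp (((j : ℂ) - n) * θ * I)) =
        fun θ : ℝ => ∑ j ∈ range (2 * n + 1),
          (d j * (((j : ℂ) - n) * I)) * cexp (((j : ℂ) - n) * θ * I) := by
      funext θ
      rw [(hasDerivAt_expSum n d θ).deriv]
      exact sum_congr rfl fun j _ => by ring
    rw [hderiv]
    have hM' : ∀ θ : ℝ,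
        ‖∑ j ∈ range (2 * n + 1), (d j * (((j : ℂ) - n) * I)) * cexp (((j : ℂ) - n) * θ * I)‖ ≤
          n * M := by
      intro θ
      have h := trigBernstein_expSum n d hM θ
      have : ∑ j ∈ range (2 * n + 1), (d j * (((j : ℂ) - n) * I)) * cexp (((j : ℂ) - n) * θ * I) =
          ∑ j ∈ range (2 * n + 1), d j * ((((j : ℂ) - n) * I) * cexp (((j : ℂ) - n) * θ * I)) :=
        sum_congr rfl fun j _ => by ring
      rwa [this]
    calc ‖deriv^[m] (fun θ : ℝ => ∑ j ∈ range (2 * n + 1),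
            (d j * (((j : ℂ) - n) * I)) * cexp (((j : ℂ) - n) * θ * I)) θ‖ ≤ (n : ℝ) ^ m * (n * M) :=
          ih _ hM' θ
      _ = (n : ℝ) ^ (m + 1) * M := by ring

/-! ## Real trigonometric polynomials `t(θ) = Σ_{k ≤ n} (a_k cos kθ + b_k sin kθ)` -/

/-- The derivative of `t(θ) = Σ_{k ≤ n} (a_k cos kθ + b_k sin kθ)` is
`t'(θ) = Σ_{k ≤ n} k(−a_k sin kθ + b_k cos kθ)`. [folklore] -/
private theorem hasDerivAt_cosSinSum (n : ℕ) (a b : ℕ → ℝ) (θ : ℝ) :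
    HasDerivAt (fun θ : ℝ => ∑ k ∈ range (n + 1), (a k * Real.cos (k * θ) + b k * Real.sin (k * θ)))
      (∑ k ∈ range (n + 1), (k : ℝ) * (-a k * Real.sin (k * θ) + b k * Real.cos (k * θ))) θ := by
  refine HasDerivAt.fun_sum fun k _ => ?_
  have hlin : HasDerivAt (fun θ : ℝ => (k : ℝ) * θ) (k : ℝ) θ := by
    simpa using (hasDerivAt_id θ).const_mul (k : ℝ)
  have hc : HasDerivAt (fun θ : ℝ => Real.cos ((k : ℝ) * θ)) (-Real.sin ((k : ℝ) * θ) * k) θ :=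
    (Real.hasDerivAt_cos ((k : ℝ) * θ)).comp θ hlin
  have hs : HasDerivAt (fun θ : ℝ => Real.sin ((k : ℝ) * θ)) (Real.cos ((k : ℝ) * θ) * k) θ :=
    (Real.hasDerivAt_sin ((k : ℝ) * θ)).comp θ hlin
  have h := (hc.const_mul (a k)).fun_add (hs.const_mul (b k))
  convert h using 1
  ring

/-- `deriv t = t'` for the real trigonometric polynomial `t` (as functions).
[cite: BorweinErdelyi1995, §5.1 Thm 5.1.4 (p. 233)] -/
theorem deriv_cosSinSum (n : ℕ) (a b : ℕ → ℝ) :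
    deriv (fun θ : ℝ => ∑ k ∈ range (n + 1), (a k * Real.cos (k * θ) + b k * Real.sin (k * θ))) =
      fun θ : ℝ => ∑ k ∈ range (n + 1), (k : ℝ) * (-a k * Real.sin (k * θ) + b k * Real.cos (k * θ)) :=
  funext fun θ => (hasDerivAt_cosSinSum n a b θ).deriv

/-- The polynomial `Q = Σ_{k ≤ n} (α_k X^{n+k} + β_k X^{n−k})`, `α_k = (a_k − ib_k)/2`,
`β_k = (a_k + ib_k)/2`, attached to `t` has degree at most `2n`. [cite: SheilSmall2002, §4.4 (p. 152)] -/
theorem natDegree_cosSinPoly_le (n : ℕ) (a b : ℕ → ℝ) :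
    (∑ k ∈ range (n + 1), (C (((a k : ℂ) - I * b k) / 2) * X ^ (n + k) +
        C (((a k : ℂ) + I * b k) / 2) * X ^ (n - k)) : ℂ[X]).natDegree ≤ 2 * n := by
  refine natDegree_sum_le_of_forall_le _ _ fun k hk => ?_
  have hk' : k ≤ n := Nat.lt_succ_iff.1 (mem_range.1 hk)
  refine (natDegree_add_le _ _).trans (max_le ?_ ?_)
  · exact (natDegree_C_mul_X_pow_le _ _).trans (by omega)
  · exact (natDegree_C_mul_X_pow_le _ _).trans (by omega)

/-- Euler: `α e^{ix} + β e^{−ix} = a cos x + b sin x` for `α = (a − ib)/2`, `β = (a + ib)/2`.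
[folklore] -/
private theorem euler_cos_sin (a b x : ℝ) :
    ((a : ℂ) - I * b) / 2 * cexp (x * I) + ((a : ℂ) + I * b) / 2 * cexp (-(x : ℂ) * I) =
      (a * Real.cos x + b * Real.sin x : ℝ) := by
  push_cast
  rw [show -(x : ℂ) * I = ((-x : ℝ) : ℂ) * I by push_cast; ring, exp_mul_I, exp_mul_I]
  push_cast
  rw [Complex.cos_neg, Complex.sin_neg]
  linear_combination (-(b : ℂ) * Complex.sin x) * I_sq

/-- `t(θ) e^{inθ} = Q(e^{iθ})` for the real trigonometric polynomial `t` and its polynomial `Q`.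
[cite: BorweinErdelyi1995, §5.1 proof of Cor. 5.1.6 (p. 233)] [cite: SheilSmall2002, §4.4 (p. 152)] -/
theorem cosSinSum_mul_cexp (n : ℕ) (a b : ℕ → ℝ) (θ : ℝ) :
    ((∑ k ∈ range (n + 1), (a k * Real.cos (k * θ) + b k * Real.sin (k * θ)) : ℝ) : ℂ) *
        cexp (n * θ * I) =
      (∑ k ∈ range (n + 1), (C (((a k : ℂ) - I * b k) / 2) * X ^ (n + k) +
        C (((a k : ℂ) + I * b k) / 2) * X ^ (n - k)) : ℂ[X]).eval (cexp (θ * I)) := by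
  rw [eval_finsetSum, ofReal_sum, sum_mul]
  refine sum_congr rfl fun k hk => ?_
  have hkn : k ≤ n := Nat.lt_succ_iff.1 (mem_range.1 hk)
  have hA : cexp ((((k : ℝ) * θ : ℝ) : ℂ) * I) * cexp (n * θ * I) =
      cexp (((n + k : ℕ) : ℂ) * ((θ : ℂ) * I)) := by
    rw [← Complex.exp_add]; congr 1; push_cast; ring
  have hB : cexp (-(((k : ℝ) * θ : ℝ) : ℂ) * I) * cexp (n * θ * I) =
      cexp (((n - k : ℕ) : ℂ) * ((θ : ℂ) * I)) := by
    rw [← Complex.exp_add]; congr 1; rw [Nat.cast_sub hkn]; push_cast; ring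
  simp only [eval_add, eval_mul, eval_C, eval_pow, eval_X]
  rw [← Complex.exp_nat_mul, ← Complex.exp_nat_mul, ← euler_cos_sin (a k) (b k) (k * θ)]
  linear_combination (((a k : ℂ) - I * b k) / 2) * hA + (((a k : ℂ) + I * b k) / 2) * hB

/-- **The Bernstein–Szegő inequality (Borwein–Erdélyi Theorem 5.1.3; van der Corput–Schaake,
Szegő):** for a real trigonometric polynomial `t(θ) = Σ_{k=0}^{n} (a_k cos kθ + b_k sin kθ)` with
`|t(θ)| ≤ M` for all real `θ`,
`t'(θ)² + n² t(θ)² ≤ n² M²` for every real `θ` (`t'(θ) = Σ k(−a_k sin kθ + b_k cos kθ)`).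
[cite: BorweinErdelyi1995, §5.1 Thm 5.1.3 (pp. 232–233)] -/
theorem bernsteinSzego (n : ℕ) (a b : ℕ → ℝ) {M : ℝ}
    (hM : ∀ θ : ℝ, |∑ k ∈ range (n + 1), (a k * Real.cos (k * θ) + b k * Real.sin (k * θ))| ≤ M)
    (θ : ℝ) :
    (∑ k ∈ range (n + 1), (k : ℝ) * (-a k * Real.sin (k * θ) + b k * Real.cos (k * θ))) ^ 2 +
        (n : ℝ) ^ 2 * (∑ k ∈ range (n + 1), (a k * Real.cos (k * θ) + b k * Real.sin (k * θ))) ^ 2 ≤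
      (n : ℝ) ^ 2 * M ^ 2 := by
  set t : ℝ → ℝ := fun θ => ∑ k ∈ range (n + 1), (a k * Real.cos (k * θ) + b k * Real.sin (k * θ))
    with ht
  set t' : ℝ → ℝ := fun θ => ∑ k ∈ range (n + 1), (k : ℝ) * (-a k * Real.sin (k * θ) + b k * Real.cos (k * θ))
    with ht'
  have hF : HasDerivAt (fun θ : ℝ => ((t θ : ℝ) : ℂ)) (((t' θ : ℝ) : ℂ)) θ :=
    (hasDerivAt_cosSinSum n a b θ).ofReal_comp
  have hMc : ∀ θ : ℝ, ‖((t θ : ℝ) : ℂ)‖ ≤ M := fun θ => by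
    rw [Complex.norm_real, Real.norm_eq_abs]; exact hM θ
  have h := sq_add_sq_le_of_repr (natDegree_cosSinPoly_le n a b) (F := fun θ => ((t θ : ℝ) : ℂ))
    (F' := fun θ => ((t' θ : ℝ) : ℂ)) (cosSinSum_mul_cexp n a b) hMc hF (ofReal_im _) (ofReal_im _)
  simpa only [ofReal_re] using h

/-- **Bernstein's inequality for real trigonometric polynomials (Borwein–Erdélyi Theorem 5.1.4 with
`m = 1`; Sheil-Small Theorem 4.4.7; S. N. Bernstein 1912):** if
`t(θ) = Σ_{k=0}^{n} (a_k cos kθ + b_k sin kθ)` satisfies `|t(θ)| ≤ M` for all real `θ`, then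
`|t'(θ)| ≤ n·M` for all real `θ`.
[cite: BorweinErdelyi1995, §5.1 Thm 5.1.4 (p. 233)] [cite: SheilSmall2002, §4.4.7 Theorem (4.189) (p. 154)] -/
theorem trigBernstein (n : ℕ) (a b : ℕ → ℝ) {M : ℝ}
    (hM : ∀ θ : ℝ, |∑ k ∈ range (n + 1), (a k * Real.cos (k * θ) + b k * Real.sin (k * θ))| ≤ M)
    (θ : ℝ) :
    |∑ k ∈ range (n + 1), (k : ℝ) * (-a k * Real.sin (k * θ) + b k * Real.cos (k * θ))| ≤ n * M := by
  have h := bernsteinSzego n a b hM θ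
  have hM0 : 0 ≤ M := (abs_nonneg _).trans (hM 0)
  have hsq : (∑ k ∈ range (n + 1), (k : ℝ) * (-a k * Real.sin (k * θ) + b k * Real.cos (k * θ))) ^ 2
      ≤ (n * M) ^ 2 := by nlinarith [sq_nonneg (∑ k ∈ range (n + 1), (a k * Real.cos (k * θ) + b k * Real.sin (k * θ)))]
  exact abs_le_of_sq_le_sq' hsq (by positivity) |>.elim (fun h1 h2 => abs_le.2 ⟨h1, h2⟩)

/-- `deriv` form: `|deriv t θ| ≤ n·M`. [cite: BorweinErdelyi1995, §5.1 Thm 5.1.4 (p. 233)] -/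
theorem trigBernstein_deriv (n : ℕ) (a b : ℕ → ℝ) {M : ℝ}
    (hM : ∀ θ : ℝ, |∑ k ∈ range (n + 1), (a k * Real.cos (k * θ) + b k * Real.sin (k * θ))| ≤ M)
    (θ : ℝ) :
    |deriv (fun θ : ℝ => ∑ k ∈ range (n + 1), (a k * Real.cos (k * θ) + b k * Real.sin (k * θ))) θ| ≤
      n * M := by
  rw [(hasDerivAt_cosSinSum n a b θ).deriv]
  exact trigBernstein n a b hM θ

/-- **Borwein–Erdélyi Theorem 5.1.4 (all orders):** `‖t^{(m)}‖ ≤ nᵐ‖t‖` for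
`t(θ) = Σ_{k=0}^{n} (a_k cos kθ + b_k sin kθ)` — «by induction on m», `t'` being again in `𝒯ₙ` with
coefficients `(k b_k, −k a_k)`. [cite: BorweinErdelyi1995, §5.1 Thm 5.1.4 (p. 233)] -/
theorem trigBernstein_iterate (n : ℕ) (a b : ℕ → ℝ) {M : ℝ}
    (hM : ∀ θ : ℝ, |∑ k ∈ range (n + 1), (a k * Real.cos (k * θ) + b k * Real.sin (k * θ))| ≤ M)
    (m : ℕ) (θ : ℝ) :
    |deriv^[m] (fun θ : ℝ => ∑ k ∈ range (n + 1), (a k * Real.cos (k * θ) + b k * Real.sin (k * θ))) θ|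
      ≤ (n : ℝ) ^ m * M := by
  induction m generalizing a b M θ with
  | zero => simpa using hM θ
  | succ m ih =>
    rw [Function.iterate_succ_apply, deriv_cosSinSum]
    -- `t'` is the trigonometric polynomial with cosine coefficients `k b_k` and sine coefficients `−k a_k`
    have hform : (fun θ : ℝ => ∑ k ∈ range (n + 1), (k : ℝ) * (-a k * Real.sin (k * θ) + b k * Real.cos (k * θ)))
        = fun θ : ℝ => ∑ k ∈ range (n + 1),
          ((k * b k) * Real.cos (k * θ) + (-(k * a k)) * Real.sin (k * θ)) := by
      funext θ; exact sum_congr rfl fun k _ => by ring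
    have hM' : ∀ θ : ℝ, |∑ k ∈ range (n + 1),
        ((k * b k) * Real.cos (k * θ) + (-(k * a k)) * Real.sin (k * θ))| ≤ n * M := by
      intro θ
      have h := trigBernstein n a b hM θ
      rwa [show (∑ k ∈ range (n + 1), (k : ℝ) * (-a k * Real.sin (k * θ) + b k * Real.cos (k * θ))) =
        ∑ k ∈ range (n + 1), ((k * b k) * Real.cos (k * θ) + (-(k * a k)) * Real.sin (k * θ)) from
        sum_congr rfl fun k _ => by ring] at h
    rw [hform]
    calc |deriv^[m] (fun θ : ℝ => ∑ k ∈ range (n + 1),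
            ((k * b k) * Real.cos (k * θ) + (-(k * a k)) * Real.sin (k * θ))) θ| ≤ (n : ℝ) ^ m * (n * M) :=
          ih (fun k => k * b k) (fun k => -(k * a k)) hM' θ
      _ = (n : ℝ) ^ (m + 1) * M := by ring

/-- Real trigonometric polynomials are bounded: `|t(θ)| ≤ Σ_k (|a_k| + |b_k|)`. [folklore] -/
private theorem abs_cosSinSum_le (n : ℕ) (a b : ℕ → ℝ) (θ : ℝ) :
    |∑ k ∈ range (n + 1), (a k * Real.cos (k * θ) + b k * Real.sin (k * θ))| ≤
      ∑ k ∈ range (n + 1), (|a k| + |b k|) := by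
  refine (abs_sum_le_sum_abs _ _).trans (sum_le_sum fun k _ => ?_)
  refine (abs_add_le _ _).trans (add_le_add ?_ ?_)
  · rw [abs_mul]
    exact mul_le_of_le_one_right (abs_nonneg _) (Real.abs_cos_le_one _)
  · rw [abs_mul]
    exact mul_le_of_le_one_right (abs_nonneg _) (Real.abs_sin_le_one _)

/-- The range of `|t|` is bounded above (the hypothesis `hbdd` of
`Literature.Analysis.ValidatedNumerics.abs_le_grid_div`). [folklore] -/
private theorem bddAbove_range_abs_cosSinSum (n : ℕ) (a b : ℕ → ℝ) :
    BddAbove (Set.range fun y : ℝ =>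
      |∑ k ∈ range (n + 1), (a k * Real.cos (k * y) + b k * Real.sin (k * y))|) :=
  ⟨∑ k ∈ range (n + 1), (|a k| + |b k|), by rintro _ ⟨y, rfl⟩; exact abs_cosSinSum_le n a b y⟩

/-- **Bernstein's inequality in the `sSup` form consumed by validated numerics** — exactly the
hypothesis `hB` of `Literature.Analysis.ValidatedNumerics.abs_le_grid_div` (there «quoted, not
proved»; its other hypothesis `hbdd` is `bddAbove_range_abs_cosSinSum`'s statement, immediate from
`|t| ≤ Σ(|a_k| + |b_k|)`): for the real trigonometric polynomial
`t(θ) = Σ_{k=0}^{n} (a_k cos kθ + b_k sin kθ)` and every real `x`, `‖deriv t x‖ ≤ n · sup_y |t(y)|`.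
[cite: BorweinErdelyi1995, §5.1 Thm 5.1.4 (p. 233)] -/
theorem trigBernstein_sSup (n : ℕ) (a b : ℕ → ℝ) (x : ℝ) :
    ‖deriv (fun θ : ℝ => ∑ k ∈ range (n + 1), (a k * Real.cos (k * θ) + b k * Real.sin (k * θ))) x‖ ≤
      n * sSup (Set.range fun y : ℝ =>
        |∑ k ∈ range (n + 1), (a k * Real.cos (k * y) + b k * Real.sin (k * y))|) := by
  have hM : ∀ θ : ℝ, |∑ k ∈ range (n + 1), (a k * Real.cos (k * θ) + b k * Real.sin (k * θ))| ≤
      sSup (Set.range fun y : ℝ =>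
        |∑ k ∈ range (n + 1), (a k * Real.cos (k * y) + b k * Real.sin (k * y))|) :=
    fun θ => le_csSup (bddAbove_range_abs_cosSinSum n a b) ⟨θ, rfl⟩
  rw [Real.norm_eq_abs]
  exact trigBernstein_deriv n a b hM x

/-- The accompanying facts for a grid certificate (`abs_le_grid_div`): `t` is differentiable and
`|t|` has bounded range. [cite: BorweinErdelyi1995, §5.1 Thm 5.1.4 (p. 233)] -/
theorem differentiable_and_bddAbove_cosSinSum (n : ℕ) (a b : ℕ → ℝ) :
    Differentiable ℝ (fun θ : ℝ => ∑ k ∈ range (n + 1), (a k * Real.cos (k * θ) + b k * Real.sin (k * θ))) ∧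
    BddAbove (Set.range fun y : ℝ =>
      |∑ k ∈ range (n + 1), (a k * Real.cos (k * y) + b k * Real.sin (k * y))|) :=
  ⟨fun θ => (hasDerivAt_cosSinSum n a b θ).differentiableAt, bddAbove_range_abs_cosSinSum n a b⟩

end Literature.Analysis.Approximation.TrigonometricBernsteinInequality

end
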